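import Mathlib
import Summits.CriticalPhenomena.CardyFormulaZ2.Theorems.CardyFlipRussoSquareFromVoronoiHubDecimationDefs
import Literature.Probability.Percolation.SitePercolationMeasure
import HarnessLib

/-!
# Centre decimation, the law — stub `stub_decimateMeasure` of line `centre-decimation`
# for crux `SquareFromVoronoiHub` (stmt-CriticalPhenomena-6434, route CardyFlipRusso, sub-problem CardyFormulaZ2)

Pure measure theory: the decimation map `decimate A : Set (ℤ² ⊕ ℤ²) → Set ℤ² × Set ℤ²` pushes
fair site percolation on the centred square lattice `G_s` forward to the annealed random-diagonal
law `diagLaw = P_{1/2} ⊗ P_{1/2}`, stated as the preimage identity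
`P_{1/2}(decimate A ⁻¹' E) = diagLaw E` for EVERY set `E` (no measurability needed, because
`decimate A` is a measurable equivalence, `MeasurableEquiv.map_apply`).

Proof (`decimate_eq_comp`).  `decimate A = Prod.swap ∘ skew ∘ split`, where
* `split ω = ({x | inl x ∈ ω}, {f | inr f ∈ ω})` splits a configuration on `ℤ² ⊕ ℤ²` into its
  site block and its face block; it carries `P_p^{ℤ² ⊕ ℤ²}` to `P_p^{ℤ²} ⊗ P_p^{ℤ²}`
  (`sitePercolation_map_split`: a product measure over a sum type is the product of the two
  partial products, `infinitePi_map_sumPiEquivProdPi`, checked on finite boxes with Mathlib's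
  uniqueness theorem `Measure.eq_infinitePi`);
* `skew (σ, τ) = (σ, {f | f ∈ τ ↔ f ∉ antiDiagFaces A (inl '' σ)})` flips the face coins on the
  anti-diagonal faces, a set depending on the site colours `σ` only; for fixed `σ` this flips a
  FIXED set of fair coins, which preserves `P_{1/2}` (`sitePercolation_half_map_flipOn`:
  `Measure.infinitePi_map_pi` and `1 - 1/2 = 1/2`), so `skew` preserves the product law by
  `MeasurePreserving.skew_product` (`measurePreserving_skew`), and it is an involution;
* `Prod.swap` exchanges the two factors (`Measure.measurePreserving_swap`).
Sources: L. T. Rolla, *Percolation on the random-diagonal square lattice*, arXiv:1704.04930, §1;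
V. Beffara, *Is critical 2D percolation universal?* (2008), §5.1.
-/

noncomputable section
open scoped Topology MeasureTheory
open Filter Set MeasureTheory
open Literature.Probability.RandomPlanarGeometry (ConformalRectangle)
open Literature.Probability.Percolation (SiteConfig sitePercolation siteConnIn siteOpenGraph half
  centredSquareGraph centredSquareEmbedding)
open Summit.CriticalPhenomena.CardyFormulaZ2.Cruxes.SquareFromVoronoiHub.VoronoiBlocks (zGs Gs crudeCrossing)

namespace Summit.CriticalPhenomena.CardyFormulaZ2.Cruxes.SquareFromVoronoiHub.CentreDecimation

namespace stub_decimateMeasureAux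

open ProbabilityTheory
open Literature.Probability.Percolation (sitePi bernoulliProp sitePercolation_eq_map)

/-! ### A product measure over a sum type is the product of the two partial products -/

/-- The preimage of a finite box under `(sumPiEquivProdPi X).symm` is the product of the two
partial boxes. [folklore] -/
theorem sumPiEquivProdPi_symm_preimage_pi {ι ι' : Type*} (X : ι ⊕ ι' → Type*)
    [∀ i, MeasurableSpace (X i)] (s : Finset (ι ⊕ ι')) (t : (i : ι ⊕ ι') → Set (X i)) :
    (MeasurableEquiv.sumPiEquivProdPi X).symm ⁻¹' Set.pi s t =
      Set.pi s.toLeft (fun i => t (.inl i)) ×ˢ Set.pi s.toRight (fun i => t (.inr i)) := by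
  ext ⟨f, g⟩
  simp [Sum.forall, MeasurableEquiv.coe_sumPiEquivProdPi_symm]

/-- **Product measures over a sum type split**: the push-forward of `⨂_{i ∈ ι ⊕ ι'} μ i` under
`sumPiEquivProdPi` is `(⨂_{i ∈ ι} μ (inl i)) ⊗ (⨂_{i' ∈ ι'} μ (inr i'))` (checked on finite boxes,
`Measure.eq_infinitePi`). [folklore] -/
theorem infinitePi_map_sumPiEquivProdPi {ι ι' : Type*} {X : ι ⊕ ι' → Type*}
    [∀ i, MeasurableSpace (X i)] (μ : (i : ι ⊕ ι') → Measure (X i))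
    [∀ i, IsProbabilityMeasure (μ i)] :
    (Measure.infinitePi μ).map (MeasurableEquiv.sumPiEquivProdPi X) =
      (Measure.infinitePi fun i => μ (.inl i)).prod (Measure.infinitePi fun i => μ (.inr i)) := by
  rw [MeasurableEquiv.map_apply_eq_iff_map_symm_apply_eq]
  refine (Measure.eq_infinitePi μ fun s t ht => ?_).symm
  rw [MeasurableEquiv.map_apply, sumPiEquivProdPi_symm_preimage_pi, Measure.prod_prod,
    Measure.infinitePi_pi _ (fun i _ => ht _), Measure.infinitePi_pi _ (fun i _ => ht _),
    Finset.prod_sum_eq_prod_toLeft_mul_prod_toRight]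

/-! ### Splitting a site configuration on `α ⊕ β` into its two blocks -/

/-- Splitting a configuration on `α ⊕ β` into its `α`-block and its `β`-block is measurable.
[folklore] -/
theorem measurable_split (α β : Type*) :
    Measurable fun ω : Set (α ⊕ β) => ({a | Sum.inl a ∈ ω}, {b | Sum.inr b ∈ ω}) := by
  refine Measurable.prodMk ?_ ?_
  · exact measurable_set_iff.2 fun a => measurable_set_mem (Sum.inl a)
  · exact measurable_set_iff.2 fun b => measurable_set_mem (Sum.inr b)

/-- **Independence of the two blocks**: splitting carries `P_p^{α ⊕ β}` to `P_p^α ⊗ P_p^β`.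
[folklore] -/
theorem sitePercolation_map_split (α β : Type*) (p : unitInterval) :
    (sitePercolation (α ⊕ β) p).map (fun ω => ({a | Sum.inl a ∈ ω}, {b | Sum.inr b ∈ ω})) =
      (sitePercolation α p).prod (sitePercolation β p) := by
  have hcomm : (fun ω : Set (α ⊕ β) => ({a | Sum.inl a ∈ ω}, {b | Sum.inr b ∈ ω})) ∘
        (fun q : α ⊕ β → Prop => {v | q v}) =
      (Prod.map (fun q : α → Prop => {a | q a}) (fun q : β → Prop => {b | q b})) ∘
        (MeasurableEquiv.sumPiEquivProdPi fun _ : α ⊕ β => Prop) := rfl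
  rw [sitePercolation_eq_map, sitePercolation_eq_map, sitePercolation_eq_map,
    Measure.map_map (measurable_split α β) measurable_setOf, hcomm,
    ← Measure.map_map (measurable_setOf.prodMap measurable_setOf) (MeasurableEquiv.measurable _)]
  simp only [sitePi]
  rw [infinitePi_map_sumPiEquivProdPi, Measure.map_prod_map _ _ measurable_setOf measurable_setOf]

/-- Splitting is measure preserving from `P_p^{α ⊕ β}` to `P_p^α ⊗ P_p^β`. [folklore] -/
theorem measurePreserving_split (α β : Type*) (p : unitInterval) :
    MeasurePreserving (fun ω : Set (α ⊕ β) => ({a | Sum.inl a ∈ ω}, {b | Sum.inr b ∈ ω}))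
      (sitePercolation (α ⊕ β) p) ((sitePercolation α p).prod (sitePercolation β p)) :=
  ⟨measurable_split α β, sitePercolation_map_split α β p⟩

/-- Splitting as a measurable equivalence `Set (α ⊕ β) ≃ᵐ Set α × Set β` (Mathlib's
`MeasurableEquiv.sumPiEquivProdPi` conjugated by `MeasurableEquiv.setOf`). [folklore] -/
theorem exists_measurableEquiv_split (α β : Type*) :
    ∃ e : Set (α ⊕ β) ≃ᵐ Set α × Set β,
      ⇑e = fun ω : Set (α ⊕ β) => ({a | Sum.inl a ∈ ω}, {b | Sum.inr b ∈ ω}) :=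
  ⟨MeasurableEquiv.setOf.symm.trans ((MeasurableEquiv.sumPiEquivProdPi fun _ : α ⊕ β => Prop).trans
    (MeasurableEquiv.setOf.prodCongr MeasurableEquiv.setOf)), rfl⟩

/-! ### Flipping a fixed set of fair coins preserves `P_{1/2}` -/

/-- A fair coin on `Prop` is invariant under `P ↦ (P ↔ c)` (the identity if `c` holds, the
negation otherwise; `1 - 1/2 = 1/2`). [folklore] -/
theorem bernoulliProp_half_map_iff (c : Prop) :
    (bernoulliProp half).map (fun P : Prop => (P ↔ c)) = bernoulliProp half := by
  rw [bernoulliProp, map_bernoulliMeasure]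
  by_cases hc : c
  · simp only [hc, iff_true]
  · have hs : unitInterval.symm half = half := Subtype.ext (by simp [half]; norm_num)
    simp only [hc, iff_false, not_true_eq_false]
    rw [bernoulliMeasure_def, bernoulliMeasure_def, add_comm, hs]

/-- **Flipping the coins of a fixed set `D` preserves fair site percolation**:
`τ ↦ {b | b ∈ τ ↔ b ∉ D}` (flip exactly the coordinates in `D`) maps `P_{1/2}` to itself
(`Measure.infinitePi_map_pi`, coordinatewise `bernoulliProp_half_map_iff`). [folklore] -/
theorem sitePercolation_half_map_flipOn {β : Type*} (D : Set β) :
    (sitePercolation β half).map (fun τ : Set β => {b | b ∈ τ ↔ b ∉ D}) = sitePercolation β half := by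
  have hcoord : ∀ b : β, Measurable fun P : Prop => (P ↔ b ∉ D) := fun b => Measurable.of_discrete
  have hpi : Measurable fun (q : β → Prop) (b : β) => (q b ↔ b ∉ D) :=
    measurable_pi_lambda _ fun b => (hcoord b).comp (measurable_pi_apply b)
  have hmeas : Measurable fun τ : Set β => {b | b ∈ τ ↔ b ∉ D} :=
    measurable_set_iff.2 fun b => (measurable_set_mem b).iff measurable_const
  have hcomm : (fun τ : Set β => {b | b ∈ τ ↔ b ∉ D}) ∘ (fun q : β → Prop => {b | q b}) =
      (fun q : β → Prop => {b | q b}) ∘ (fun (q : β → Prop) (b : β) => (q b ↔ b ∉ D)) := rfl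
  rw [sitePercolation_eq_map, Measure.map_map hmeas measurable_setOf, hcomm,
    ← Measure.map_map measurable_setOf hpi]
  simp only [sitePi]
  rw [Measure.infinitePi_map_pi _ hcoord]
  simp only [bernoulliProp_half_map_iff]

/-! ### The skew flip of the face coins on the anti-diagonal faces -/

/-- `antiDiagFaces A` reads the site block only: the configuration `inl '' {x | inl x ∈ ω}`
(same sites, all centres closed) has the same anti-diagonal faces as `ω`. [folklore] -/
theorem antiDiagFaces_image_inl (A : Set (ℤ × ℤ)) (ω : SiteConfig ((ℤ × ℤ) ⊕ (ℤ × ℤ))) :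
    antiDiagFaces A (Sum.inl '' {x | Sum.inl x ∈ ω}) = antiDiagFaces A ω := by
  ext f
  simp [antiDiagFaces]

/-- The fibre maps of the skew flip, `(σ, τ) ↦ {f | f ∈ τ ↔ f ∉ antiDiagFaces A (inl '' σ)}`, are
jointly measurable (each output coordinate is a Boolean combination of five input coordinates).
[folklore] -/
theorem measurable_flipAnti (A : Set (ℤ × ℤ)) :
    Measurable fun p : Set (ℤ × ℤ) × Set (ℤ × ℤ) =>
      {f | f ∈ p.2 ↔ f ∉ antiDiagFaces A (Sum.inl '' p.1)} := by
  refine measurable_set_iff.2 fun f => ?_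
  simp only [antiDiagFaces, Set.mem_setOf_eq, Set.mem_image, Sum.inl.injEq, exists_eq_right]
  fun_prop

/-- Flipping twice the coins of the same set of faces is the identity. [folklore] -/
theorem flipAnti_flipAnti (A σ τ : Set (ℤ × ℤ)) :
    {f | f ∈ {f | f ∈ τ ↔ f ∉ antiDiagFaces A (Sum.inl '' σ)} ↔ f ∉ antiDiagFaces A (Sum.inl '' σ)} =
      τ := by
  ext f
  simp only [Set.mem_setOf_eq]
  tauto

/-- **The skew flip preserves `P_{1/2} ⊗ P_{1/2}`** (`MeasurePreserving.skew_product`: for each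
fixed site block `σ` the fibre map flips the fixed set `antiDiagFaces A (inl '' σ)` of fair coins,
`sitePercolation_half_map_flipOn`). [folklore] -/
theorem measurePreserving_skew (A : Set (ℤ × ℤ)) :
    MeasurePreserving
      (fun p : Set (ℤ × ℤ) × Set (ℤ × ℤ) =>
        (p.1, {f | f ∈ p.2 ↔ f ∉ antiDiagFaces A (Sum.inl '' p.1)}))
      ((sitePercolation (ℤ × ℤ) half).prod (sitePercolation (ℤ × ℤ) half))
      ((sitePercolation (ℤ × ℤ) half).prod (sitePercolation (ℤ × ℤ) half)) :=
  (MeasurePreserving.id _).skew_product (measurable_flipAnti A)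
    (Eventually.of_forall fun σ => sitePercolation_half_map_flipOn (antiDiagFaces A (Sum.inl '' σ)))

/-- The skew flip is a measurable involution, hence a measurable equivalence. [folklore] -/
theorem exists_measurableEquiv_skew (A : Set (ℤ × ℤ)) :
    ∃ e : Set (ℤ × ℤ) × Set (ℤ × ℤ) ≃ᵐ Set (ℤ × ℤ) × Set (ℤ × ℤ),
      ⇑e = fun p : Set (ℤ × ℤ) × Set (ℤ × ℤ) =>
        (p.1, {f | f ∈ p.2 ↔ f ∉ antiDiagFaces A (Sum.inl '' p.1)}) :=
  ⟨MeasurableEquiv.ofInvolutive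
      (fun p : Set (ℤ × ℤ) × Set (ℤ × ℤ) =>
        (p.1, {f | f ∈ p.2 ↔ f ∉ antiDiagFaces A (Sum.inl '' p.1)}))
      (fun p => Prod.ext rfl (flipAnti_flipAnti A p.1 p.2))
      (measurable_fst.prodMk (measurable_flipAnti A)),
    rfl⟩

/-! ### `decimate A` is a measure-preserving measurable equivalence -/

/-- `decimate A = swap ∘ skew ∘ split`. [folklore] -/
theorem decimate_eq_comp (A : Set (ℤ × ℤ)) :
    decimate A =
      Prod.swap ∘
        (fun p : Set (ℤ × ℤ) × Set (ℤ × ℤ) =>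
          (p.1, {f | f ∈ p.2 ↔ f ∉ antiDiagFaces A (Sum.inl '' p.1)})) ∘
        (fun ω : Set ((ℤ × ℤ) ⊕ (ℤ × ℤ)) => ({a | Sum.inl a ∈ ω}, {b | Sum.inr b ∈ ω})) := by
  funext ω
  simp only [Function.comp_apply, Prod.swap_prod_mk, decimate, antiDiagFaces_image_inl,
    Set.mem_setOf_eq]

/-- **`decimate A` is measure preserving** from fair site percolation on `G_s` to `diagLaw`
(composition of the three measure-preserving stages). [cite: Rolla2019, §1] -/
theorem measurePreserving_decimate (A : Set (ℤ × ℤ)) :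
    MeasurePreserving (decimate A) (sitePercolation ((ℤ × ℤ) ⊕ (ℤ × ℤ)) half) diagLaw := by
  rw [decimate_eq_comp]
  exact (Measure.measurePreserving_swap.comp (measurePreserving_skew A)).comp
    (measurePreserving_split (ℤ × ℤ) (ℤ × ℤ) half)

/-- **`decimate A` is a measurable equivalence** (split, skew-flip, swap). [folklore] -/
theorem exists_measurableEquiv_decimate (A : Set (ℤ × ℤ)) :
    ∃ e : Set ((ℤ × ℤ) ⊕ (ℤ × ℤ)) ≃ᵐ Set (ℤ × ℤ) × Set (ℤ × ℤ), ⇑e = decimate A := by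
  obtain ⟨e₁, he₁⟩ := exists_measurableEquiv_split (ℤ × ℤ) (ℤ × ℤ)
  obtain ⟨e₂, he₂⟩ := exists_measurableEquiv_skew A
  refine ⟨e₁.trans (e₂.trans MeasurableEquiv.prodComm), ?_⟩
  rw [decimate_eq_comp, MeasurableEquiv.coe_trans, MeasurableEquiv.coe_trans, he₁, he₂]
  rfl

end stub_decimateMeasureAux

open stub_decimateMeasureAux in
/-- **stub_decimateMeasure** (CD, law): `decimate A` transports critical site percolation on `G_s`
to the annealed random-diagonal law `diagLaw` — for EVERY set `E`, since `decimate A` is a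
measure-preserving measurable equivalence (the centre coins are flipped on a set of faces determined
by the independent site colours, which preserves the fair product law,
`MeasurePreserving.skew_product`; then `MeasurableEquiv.map_apply`). [cite: Rolla2019, §1] -/
theorem stub_decimateMeasure :
    ∀ (A : Set (ℤ × ℤ)) (E : Set (Set (ℤ × ℤ) × Set (ℤ × ℤ))),
      sitePercolation ((ℤ × ℤ) ⊕ (ℤ × ℤ)) half (decimate A ⁻¹' E) = diagLaw E := by
  intro A E
  obtain ⟨e, he⟩ := exists_measurableEquiv_decimate A
  rw [← (measurePreserving_decimate A).map_eq, ← he, MeasurableEquiv.map_apply]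

end Summit.CriticalPhenomena.CardyFormulaZ2.Cruxes.SquareFromVoronoiHub.CentreDecimation

end
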